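import Summits.Ventures.PercRepro2.CaseOneGadgetUWOB

/-!
# The gadget `u ~ {w, a₁}`, `w ~ {u, a₂, o, b}` — pointwise structure (the uwa1 shape)
(blind cell PercRepro2, p1 g22; S5 §2.1 (K9): the second unmarked-neighbour shape, the structural
layer for its `(i)` / `(i-Q)` certificate chain — P1-G21 §4 (3), P1-G22 §5)

`IsGadgetUWA1`: the five edges `euw = {w, u}`, `eua1 = {a₁, u}`, `ewa2 = {a₂, w}`, `ewo = {o, w}`,
`ewb = {b, w}` are all the edges at `u` and at `w`. With all five closed both centres are isolated
(`base5`); the bridge invariant of `CaseOneStar.lean` is applied TWICE: stage 1 opens the three edges of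
`w` to `a₂, o, b` (centre `w` over the base; `u` is still isolated), stage 2 opens the two edges of `u`
(centre `u` over the stage-1 configuration). So **`conn_open5_iff`** reads a connection among vertices
`≠ u` in `open5` as a connection in the stage-1 configuration or one through `u` via two open
neighbours of `u` (in `{w, a₁}`), and **`conn_stage1_iff`** / **`conn_stage1_w_iff`** read the stage-1
connections in the base (`w` bridges its open neighbours among `a₂, o, b`). The same architecture as
`CaseOneGadgetUWOB.lean` (whose `bridgeInv_of_isolated` is reused) with the roles of the two centres exchanged; the pinning, the cells and the
masses are to be generated from these lemmas. Own code; standard axioms. -/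

namespace Summit.Ventures.PercRepro2

namespace CaseOne

section GadgetUWA1
variable {V : Type*} {E : Type*} [DecidableEq E]

/-- **The gadget**: `u`'s edges are exactly `euw, eua1` and `w`'s edges exactly `euw, ewa2, ewo, ewb`. -/
structure IsGadgetUWA1 (ends : E → Sym2 V) (o a₁ a₂ b u w : V) (euw eua1 ewa2 ewo ewb : E) : Prop where
  /-- the edge `{w, u}` -/
  ends_uw : ends euw = s(w, u)
  /-- the edge `{a₁, u}` -/
  ends_ua1 : ends eua1 = s(a₁, u)
  /-- the edge `{a₂, w}` -/
  ends_wa2 : ends ewa2 = s(a₂, w)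
  /-- the edge `{o, w}` -/
  ends_wo : ends ewo = s(o, w)
  /-- the edge `{b, w}` -/
  ends_wb : ends ewb = s(b, w)
  /-- distinct edges -/
  ne_uw_ua1 : euw ≠ eua1
  /-- distinct edges -/
  ne_uw_wa2 : euw ≠ ewa2
  /-- distinct edges -/
  ne_uw_wo : euw ≠ ewo
  /-- distinct edges -/
  ne_uw_wb : euw ≠ ewb
  /-- distinct edges -/
  ne_ua1_wa2 : eua1 ≠ ewa2
  /-- distinct edges -/
  ne_ua1_wo : eua1 ≠ ewo
  /-- distinct edges -/
  ne_ua1_wb : eua1 ≠ ewb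
  /-- distinct edges -/
  ne_wa2_wo : ewa2 ≠ ewo
  /-- distinct edges -/
  ne_wa2_wb : ewa2 ≠ ewb
  /-- distinct edges -/
  ne_wo_wb : ewo ≠ ewb
  /-- no other edge at `u` -/
  unique_u : ∀ e, u ∈ ends e → e = euw ∨ e = eua1
  /-- no other edge at `w` -/
  unique_w : ∀ e, w ∈ ends e → e = euw ∨ e = ewa2 ∨ e = ewo ∨ e = ewb
  /-- `w ≠ u` -/
  ne_wu : w ≠ u
  /-- `o ≠ u` -/
  ne_ou : o ≠ u
  /-- `b ≠ u` -/
  ne_bu : b ≠ u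
  /-- `a₁ ≠ u` -/
  ne_a1u : a₁ ≠ u
  /-- `a₂ ≠ u` -/
  ne_a2u : a₂ ≠ u
  /-- `a₁ ≠ w` -/
  ne_a1w : a₁ ≠ w
  /-- `a₂ ≠ w` -/
  ne_a2w : a₂ ≠ w
  /-- `o ≠ w` -/
  ne_ow : o ≠ w
  /-- `b ≠ w` -/
  ne_bw : b ≠ w

variable {ends : E → Sym2 V} {o a₁ a₂ b u w : V} {euw eua1 ewa2 ewo ewb : E}

/-- The configuration with the five gadget edges closed. -/
def base5A (euw eua1 ewa2 ewo ewb : E) (ω : Config E) : Config E :=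
  Function.update (Function.update (Function.update (Function.update (Function.update ω euw false) eua1 false)
    ewa2 false) ewo false) ewb false

/-- The stage-1 configuration: the three edges of `w` in the states `c₂, co, cb` (from the base). -/
def stage1A (euw eua1 ewa2 ewo ewb : E) (c₂ co cb : Bool) (ω : Config E) : Config E :=
  Function.update (Function.update (Function.update (base5A euw eua1 ewa2 ewo ewb ω) ewa2 c₂) ewo co) ewb cb

/-- The configuration with the five gadget edges in the states `(cw, c₁)` at `u` and `(c₂, co, cb)` at
`w`. -/
def open5A (euw eua1 ewa2 ewo ewb : E) (cw c₁ c₂ co cb : Bool) (ω : Config E) : Config E :=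
  Function.update (Function.update (stage1A euw eua1 ewa2 ewo ewb c₂ co cb ω) euw cw) eua1 c₁

/-- The open neighbours of `w` among `a₂, o, b`. -/
def nbrWA (a₂ o b : V) (c₂ co cb : Bool) (v : V) : Prop :=
  (c₂ = true ∧ v = a₂) ∨ (co = true ∧ v = o) ∨ (cb = true ∧ v = b)

/-- The open neighbours of `u` among `w, a₁`. -/
def nbrUA (w a₁ : V) (cw c₁ : Bool) (v : V) : Prop := (cw = true ∧ v = w) ∨ (c₁ = true ∧ v = a₁)

omit [DecidableEq E] in
/-- With its two edges closed, `u` is isolated. -/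
lemma isolated_uA (h : IsGadgetUWA1 ends o a₁ a₂ b u w euw eua1 ewa2 ewo ewb) {ω : Config E}
    (h1 : ω euw = false) (h2 : ω eua1 = false) {x : V} (hx : Conn ends ω u x) : x = u := by
  have hS : ∀ y ∈ ({u} : Set V), ∀ z, (openGraph ends ω).Adj y z → z ∈ ({u} : Set V) := by
    intro y hy z hyz
    rw [Set.mem_singleton_iff] at hy
    rw [hy] at hyz
    obtain ⟨_, e, he, hends⟩ := openGraph_adj.1 hyz
    have hu : u ∈ ends e := by rw [hends]; exact Sym2.mem_mk_left _ _
    rcases h.unique_u e hu with rfl | rfl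
    · rw [h1] at he; exact Bool.noConfusion he
    · rw [h2] at he; exact Bool.noConfusion he
  exact mem_of_conn_of_closed hS (Set.mem_singleton u) hx

omit [DecidableEq E] in
/-- With its four edges closed, `w` is isolated. -/
lemma isolated_wA (h : IsGadgetUWA1 ends o a₁ a₂ b u w euw eua1 ewa2 ewo ewb) {ω : Config E}
    (h1 : ω euw = false) (h2 : ω ewa2 = false) (h3 : ω ewo = false) (h4 : ω ewb = false) {x : V}
    (hx : Conn ends ω w x) : x = w := by
  have hS : ∀ y ∈ ({w} : Set V), ∀ z, (openGraph ends ω).Adj y z → z ∈ ({w} : Set V) := by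
    intro y hy z hyz
    rw [Set.mem_singleton_iff] at hy
    rw [hy] at hyz
    obtain ⟨_, e, he, hends⟩ := openGraph_adj.1 hyz
    have hw : w ∈ ends e := by rw [hends]; exact Sym2.mem_mk_left _ _
    rcases h.unique_w e hw with rfl | rfl | rfl | rfl
    · rw [h1] at he; exact Bool.noConfusion he
    · rw [h2] at he; exact Bool.noConfusion he
    · rw [h3] at he; exact Bool.noConfusion he
    · rw [h4] at he; exact Bool.noConfusion he
  exact mem_of_conn_of_closed hS (Set.mem_singleton w) hx

/-- `base5A` has the five edges closed. -/
lemma base5A_uw (h : IsGadgetUWA1 ends o a₁ a₂ b u w euw eua1 ewa2 ewo ewb) (ω : Config E) :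
    base5A euw eua1 ewa2 ewo ewb ω euw = false := by
  simp [base5A, Function.update_of_ne h.ne_uw_wb, Function.update_of_ne h.ne_uw_wo,
    Function.update_of_ne h.ne_uw_wa2, Function.update_of_ne h.ne_uw_ua1]

/-- `base5A` has the five edges closed. -/
lemma base5A_ua1 (h : IsGadgetUWA1 ends o a₁ a₂ b u w euw eua1 ewa2 ewo ewb) (ω : Config E) :
    base5A euw eua1 ewa2 ewo ewb ω eua1 = false := by
  simp [base5A, Function.update_of_ne h.ne_ua1_wb, Function.update_of_ne h.ne_ua1_wo,
    Function.update_of_ne h.ne_ua1_wa2]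

/-- `base5A` has the five edges closed. -/
lemma base5A_wa2 (h : IsGadgetUWA1 ends o a₁ a₂ b u w euw eua1 ewa2 ewo ewb) (ω : Config E) :
    base5A euw eua1 ewa2 ewo ewb ω ewa2 = false := by
  simp [base5A, Function.update_of_ne h.ne_wa2_wb, Function.update_of_ne h.ne_wa2_wo]

/-- `base5A` has the five edges closed. -/
lemma base5A_wo (h : IsGadgetUWA1 ends o a₁ a₂ b u w euw eua1 ewa2 ewo ewb) (ω : Config E) :
    base5A euw eua1 ewa2 ewo ewb ω ewo = false := by
  simp [base5A, Function.update_of_ne h.ne_wo_wb]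

/-- `base5A` has the five edges closed. -/
lemma base5A_wb (ω : Config E) : base5A euw eua1 ewa2 ewo ewb ω ewb = false := by simp [base5A]

/-- The stage-1 configuration has the two edges of `u` closed. -/
lemma stage1A_uw (h : IsGadgetUWA1 ends o a₁ a₂ b u w euw eua1 ewa2 ewo ewb) (c₂ co cb : Bool)
    (ω : Config E) : stage1A euw eua1 ewa2 ewo ewb c₂ co cb ω euw = false := by
  simp [stage1A, Function.update_of_ne h.ne_uw_wb, Function.update_of_ne h.ne_uw_wo,
    Function.update_of_ne h.ne_uw_wa2, base5A_uw h ω]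

/-- The stage-1 configuration has the two edges of `u` closed. -/
lemma stage1A_ua1 (h : IsGadgetUWA1 ends o a₁ a₂ b u w euw eua1 ewa2 ewo ewb) (c₂ co cb : Bool)
    (ω : Config E) : stage1A euw eua1 ewa2 ewo ewb c₂ co cb ω eua1 = false := by
  simp [stage1A, Function.update_of_ne h.ne_ua1_wb, Function.update_of_ne h.ne_ua1_wo,
    Function.update_of_ne h.ne_ua1_wa2, base5A_ua1 h ω]

/-- **Stage 1: `w` bridges its open neighbours among `a₂, o, b`** over the base. -/
theorem bridgeInv_stage1A (h : IsGadgetUWA1 ends o a₁ a₂ b u w euw eua1 ewa2 ewo ewb) (ω : Config E)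
    (c₂ co cb : Bool) :
    BridgeInv ends w (base5A euw eua1 ewa2 ewo ewb ω) (stage1A euw eua1 ewa2 ewo ewb c₂ co cb ω)
      (nbrWA a₂ o b c₂ co cb) := by
  have s0 : BridgeInv ends w (base5A euw eua1 ewa2 ewo ewb ω) (base5A euw eua1 ewa2 ewo ewb ω)
      (fun _ => False) :=
    bridgeInv_of_isolated fun x hx hc =>
      hx (isolated_wA h (base5A_uw h ω) (base5A_wa2 h ω) (base5A_wo h ω) (base5A_wb ω) (conn_symm hc))
  have s1 := bridgeInv_flag h.ends_wa2 h.ne_a2w s0 c₂ (base5A_wa2 h ω)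
  have s2 := bridgeInv_flag h.ends_wo h.ne_ow s1 co
    (by rw [Function.update_of_ne h.ne_wa2_wo.symm]; exact base5A_wo h ω)
  have s3 := bridgeInv_flag h.ends_wb h.ne_bw s2 cb
    (by rw [Function.update_of_ne h.ne_wo_wb.symm, Function.update_of_ne h.ne_wa2_wb.symm]
        exact base5A_wb ω)
  refine bridgeInv_congr (fun v => ?_) s3
  unfold nbrWA
  tauto

/-- **Stage 2: `u` bridges its open neighbours among `w, a₁`** over the stage-1 configuration. -/
theorem bridgeInv_open5A (h : IsGadgetUWA1 ends o a₁ a₂ b u w euw eua1 ewa2 ewo ewb) (ω : Config E)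
    (cw c₁ c₂ co cb : Bool) :
    BridgeInv ends u (stage1A euw eua1 ewa2 ewo ewb c₂ co cb ω)
      (open5A euw eua1 ewa2 ewo ewb cw c₁ c₂ co cb ω) (nbrUA w a₁ cw c₁) := by
  have s0 : BridgeInv ends u (stage1A euw eua1 ewa2 ewo ewb c₂ co cb ω)
      (stage1A euw eua1 ewa2 ewo ewb c₂ co cb ω) (fun _ => False) :=
    bridgeInv_of_isolated fun x hx hc =>
      hx (isolated_uA h (stage1A_uw h c₂ co cb ω) (stage1A_ua1 h c₂ co cb ω) (conn_symm hc))
  have s1 := bridgeInv_flag h.ends_uw h.ne_wu s0 cw (stage1A_uw h c₂ co cb ω)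
  have s2 := bridgeInv_flag h.ends_ua1 h.ne_a1u s1 c₁
    (by rw [Function.update_of_ne h.ne_uw_ua1.symm]; exact stage1A_ua1 h c₂ co cb ω)
  refine bridgeInv_congr (fun v => ?_) s2
  unfold nbrUA
  tauto

/-- **Connections among vertices `≠ u`** in `open5A`: in the stage-1 configuration, or through `u` via
two open neighbours of `u`. -/
theorem conn_open5A_iff (h : IsGadgetUWA1 ends o a₁ a₂ b u w euw eua1 ewa2 ewo ewb) (ω : Config E)
    (cw c₁ c₂ co cb : Bool) {x y : V} (hx : x ≠ u) (hy : y ≠ u) :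
    Conn ends (open5A euw eua1 ewa2 ewo ewb cw c₁ c₂ co cb ω) x y ↔
      Conn ends (stage1A euw eua1 ewa2 ewo ewb c₂ co cb ω) x y ∨
        ∃ u' v', nbrUA w a₁ cw c₁ u' ∧ nbrUA w a₁ cw c₁ v' ∧
          Conn ends (stage1A euw eua1 ewa2 ewo ewb c₂ co cb ω) x u' ∧
          Conn ends (stage1A euw eua1 ewa2 ewo ewb c₂ co cb ω) v' y :=
  (bridgeInv_open5A h ω cw c₁ c₂ co cb).1 x y hx hy

/-- **Connections to `u`** in `open5A`: `x ↔ u` iff `x ↔ u'` in the stage-1 configuration for an open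
neighbour `u'` of `u`. -/
theorem conn_open5A_u_iff (h : IsGadgetUWA1 ends o a₁ a₂ b u w euw eua1 ewa2 ewo ewb) (ω : Config E)
    (cw c₁ c₂ co cb : Bool) {x : V} (hx : x ≠ u) :
    Conn ends (open5A euw eua1 ewa2 ewo ewb cw c₁ c₂ co cb ω) x u ↔
      ∃ u', nbrUA w a₁ cw c₁ u' ∧ Conn ends (stage1A euw eua1 ewa2 ewo ewb c₂ co cb ω) x u' :=
  (bridgeInv_open5A h ω cw c₁ c₂ co cb).2 x hx

/-- **Stage-1 connections among vertices `≠ w`**: in the base, or through `w` via two open neighbours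
of `w`. -/
theorem conn_stage1A_iff (h : IsGadgetUWA1 ends o a₁ a₂ b u w euw eua1 ewa2 ewo ewb) (ω : Config E)
    (c₂ co cb : Bool) {x y : V} (hx : x ≠ w) (hy : y ≠ w) :
    Conn ends (stage1A euw eua1 ewa2 ewo ewb c₂ co cb ω) x y ↔
      Conn ends (base5A euw eua1 ewa2 ewo ewb ω) x y ∨
        ∃ u' v', nbrWA a₂ o b c₂ co cb u' ∧ nbrWA a₂ o b c₂ co cb v' ∧
          Conn ends (base5A euw eua1 ewa2 ewo ewb ω) x u' ∧
          Conn ends (base5A euw eua1 ewa2 ewo ewb ω) v' y :=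
  (bridgeInv_stage1A h ω c₂ co cb).1 x y hx hy

/-- **Stage-1 connections to `w`**: `x ↔ w` iff `x ↔ u'` in the base for an open neighbour `u'` of
`w`. -/
theorem conn_stage1A_w_iff (h : IsGadgetUWA1 ends o a₁ a₂ b u w euw eua1 ewa2 ewo ewb) (ω : Config E)
    (c₂ co cb : Bool) {x : V} (hx : x ≠ w) :
    Conn ends (stage1A euw eua1 ewa2 ewo ewb c₂ co cb ω) x w ↔
      ∃ u', nbrWA a₂ o b c₂ co cb u' ∧ Conn ends (base5A euw eua1 ewa2 ewo ewb ω) x u' :=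
  (bridgeInv_stage1A h ω c₂ co cb).2 x hx

/-- **Stage-1 connections from `w`** (the centre first). -/
theorem conn_stage1A_w_iff' (h : IsGadgetUWA1 ends o a₁ a₂ b u w euw eua1 ewa2 ewo ewb) (ω : Config E)
    (c₂ co cb : Bool) {y : V} (hy : y ≠ w) :
    Conn ends (stage1A euw eua1 ewa2 ewo ewb c₂ co cb ω) w y ↔
      ∃ u', nbrWA a₂ o b c₂ co cb u' ∧ Conn ends (base5A euw eua1 ewa2 ewo ewb ω) y u' := by
  constructor
  · intro hc
    exact (conn_stage1A_w_iff h ω c₂ co cb hy).1 (conn_symm hc)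
  · intro hc
    exact conn_symm ((conn_stage1A_w_iff h ω c₂ co cb hy).2 hc)

/-- **Connections from `u`** in `open5A` (the centre first). -/
theorem conn_open5A_u_iff' (h : IsGadgetUWA1 ends o a₁ a₂ b u w euw eua1 ewa2 ewo ewb) (ω : Config E)
    (cw c₁ c₂ co cb : Bool) {y : V} (hy : y ≠ u) :
    Conn ends (open5A euw eua1 ewa2 ewo ewb cw c₁ c₂ co cb ω) u y ↔
      ∃ u', nbrUA w a₁ cw c₁ u' ∧ Conn ends (stage1A euw eua1 ewa2 ewo ewb c₂ co cb ω) y u' := by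
  constructor
  · intro hc
    exact (conn_open5A_u_iff h ω cw c₁ c₂ co cb hy).1 (conn_symm hc)
  · intro hc
    exact conn_symm ((conn_open5A_u_iff h ω cw c₁ c₂ co cb hy).2 hc)

/-- In the base, `u` is joined to nothing but itself. -/
lemma not_conn_base5A_u (h : IsGadgetUWA1 ends o a₁ a₂ b u w euw eua1 ewa2 ewo ewb) (ω : Config E)
    {x : V} (hx : x ≠ u) : ¬ Conn ends (base5A euw eua1 ewa2 ewo ewb ω) x u :=
  fun hc => hx (isolated_uA h (base5A_uw h ω) (base5A_ua1 h ω) (conn_symm hc))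

/-- In the base, `w` is joined to nothing but itself. -/
lemma not_conn_base5A_w (h : IsGadgetUWA1 ends o a₁ a₂ b u w euw eua1 ewa2 ewo ewb) (ω : Config E)
    {x : V} (hx : x ≠ w) : ¬ Conn ends (base5A euw eua1 ewa2 ewo ewb ω) x w :=
  fun hc => hx (isolated_wA h (base5A_uw h ω) (base5A_wa2 h ω) (base5A_wo h ω) (base5A_wb ω)
    (conn_symm hc))

/-- The base equals `ω` when the five edges are closed in `ω`. -/
lemma base5A_eq_self {ω : Config E} (h1 : ω euw = false) (h2 : ω eua1 = false) (h3 : ω ewa2 = false)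
    (h4 : ω ewo = false) (h5 : ω ewb = false) : base5A euw eua1 ewa2 ewo ewb ω = ω := by
  funext e
  simp only [base5A, Function.update_apply]
  split_ifs <;> simp_all

end GadgetUWA1

end CaseOne

end Summit.Ventures.PercRepro2
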